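/-
Copyright (c) 2026 the pub-hodgecm-mathlib formalisation cell (harness21).  Prover seat hodgecm-mathlib-K2E2-p13 (g2),
Track B «K2-LIT» ∕ h413 (stmt-HodgeConjecture-24833), line K2_E2 «ThetaExhaustionByRigidity», unit CAPTURE, socket #20a «ARCH-PAIR-HOLCOT»
(road b2, line lead K2E2-p12 (g2)), helper H4a «MIRROR KIT» (the generic half of H4 «ORIENTATION MIRROR»).  KERNEL module: THEOREMS ONLY
(no definition, no named fact, no `sorry`, no instance, no notation).  2026-09-04.
-/
import Summits.HodgeConjecture.HodgeConjecture.Theorems.H413WeilFinRepMirror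
import Summits.HodgeConjecture.HodgeCM.Model.HypCensus.ArchFactor_1
import Literature.NumberTheory.Weil1964.AdelicSchrodingerConjCont
import Literature.NumberTheory.Automorphic.Liu2021.Def411WeilCarriersDoubling
import Literature.NumberTheory.GelbartRogawski1991.UnitaryDualPairThetaKernel
import Literature.NumberTheory.Weil1964.ThetaLiftTransportMap
import Literature.NumberTheory.Automorphic.UnitaryGroupAdelicCenterRational
import Literature.NumberTheory.Automorphic.DoubledUnitaryRankOneReductionDiag
import HarnessLib


/-!
# K2_E2 road (h413 = stmt-HodgeConjecture-24833), unit CAPTURE, socket #20a, helper H4a «MIRROR KIT»: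
# complex conjugation of Weil operators, theta kernels and theta lifts along the MIRROR splitting `s̄` of a unitary dual pair

Cell `pub/hodgecm-mathlib` (D-0151), Track B; dealer K2E2-plan (g2) DEAL 2026-09-04T00:10:03Z (H4 «ORIENTATION MIRROR» → K2E2-p13), cut H4 = H4a (this
file, generic) + H4b (assembly at the packaged frame), census 00:14:35Z.  WHY: socket #20a `Capture.sig_K2E2CapArchPairHolCot` quantifies over every
`ι ∈ Φ_μ`, including the NON-canonical representative of its place (`(mk ι).embedding = conj ∘ ι`); there the holomorphic theta pairs of `(μ, ⟨a⟩, χ)` at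
`(ι, T)` are the COMPLEX CONJUGATES of those of the conjugate partner `(μ′, ⟨−a⟩, χ̄)` at the canonical frame `(conj ∘ ι, T̄)` ([Liu2021, App. D
Lem. D.1 (2)]: `\overline{ω(μ, ε, χ)} ≅ ω(μᶜ, −ε, χ⁻¹)`; [Li1992, p. 181]: «`ω*` is `ω_{ψ̄}`»).  The representation-level mirror is ★ (`H413WeilFinRepMirror`,
`H413MirrorSplittingAtScalar`, `H413MirrorAtPinLine`); THIS FILE supplies the FUNCTION-level mirror, generically for any unitary dual pair
`U(J_V) × U(J_W)` over a quadratic `E/F`, compatible splitting `s` and its mirror `s̄ = mirrorSplitting s` on `(J_V, −J_W)` (★ `HodgeCM.WeilCoinv.mirrorSplitting`):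

* §1 `piSchwartzBruhatConj_thinCosetTestFunₗ` — the finite factor of a thin-coset test function is real: `C(Φ_∞ ⊗ 𝟙) = C_∞Φ_∞ ⊗ 𝟙`.
* §2 **`archWeilRep_mirrorSplitting_apply`** — THE ARCHIMEDEAN WEIL REPRESENTATION OF `s̄` IS THE COMPLEX CONJUGATE: `archWeilRep[s̄] (x, ȳ) Ψ =
  C_∞ (archWeilRep[s] (x, y) (C_∞ Ψ))` (`ȳ` = `y` read in `U(−J_W)(E ⊗ ℝ)`): the operator law ★ `omega_pairSplitting_mirrorSplitting` read on the archimedean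
  factor through ★ `omega_thinCosetTestFunₗ` ∕ ★ `archRepMp_unique` (the pattern of ★ `K2E2CapArchPairFixedNeZero.archWeilRep_twist_apply`);
  `archWeilRep_schwartzConj_eq_self_of_mirror_eq_self` — a vector fixed by `ȳ` under `s̄` has its conjugate fixed by `y` under `s` (row (E) of #20a transfers).
* §3 **`thetaKernelDatum_mirror_thetaFun`** — THE THETA KERNEL OF `s̄` (read at any W-data `(T₂, J₂) = (−T_W, −J_W)`, ★ `splittingCongr`) IS THE CONJUGATE:
  `θ^{s̄}_Ψ(x, ū) = conj θ^{s}_{CΨ}(x, u)` (★ `thetaKernelDatum_thetaFun_mk`, the operator law, ★ `thetaDistLM_piSchwartzBruhatConj`).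
* §4 (generic `Weil1964.ThetaKernelDatum`, two carriers, a map `T` of Schwartz carriers) **`thetaKer_conj_rel_of_thetaFun_conj_rel_map`**,
  **`thetaLift_apply_of_thetaKer_conj_rel_map`** — CONJUGATE TRANSPORT OF THETA LIFTS: a conj kernel relation `θ′_Φ(x′,y′) = conj θ_{TΦ}(φU x′, φ y′)`
  descends to the coset spaces and gives `Θ′_Φ(f′)(ξ′) = conj Θ_{TΦ}(f)(b ξ′)` for `f′ = conj ∘ f ∘ a`, the unprimed lift against `a_* μ′` (the conj twin of
  ★ `ThetaLiftTransportMap.thetaLift_apply_of_thetaKer_rel_map`; `∫ conj = conj ∫`); **`thetaLift_conj_cosetCongr_apply_map`** — the same along a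
  group identification `e : G′ ≃* G` of the second factor matching the arithmetic subgroups (`a = cosetCongr e`, `f = (conj ∘ f′) ∘ ē⁻¹`), the shape H4b consumes.
* §5 the sign of `J_W` does not change the groups: `arch_neg` (`U(−J)(E ⊗ ℝ) = U(J)(E ⊗ ℝ)`), `rational_neg`, `subgroupCongr_mem_range_toAdelic_neg_iff`
  (the identification ★ `adelic_neg` matches rational points, via ★ `mem_range_toAdelic_iff`), and its continuity both ways — the `hU`∕`hΓ`∕continuity
  inputs of ★ `cosetCongr` for the quotient-measure transport in H4b.

HONEST LABEL: HC_CM is proved only modulo the 7 printed citations (2 remaining named inputs: hLiu418 = stmt-HodgeConjecture-24832,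
h413 = stmt-HodgeConjecture-24833) until rung 0 closes; this file is a `--supports stmt-HodgeConjecture-24833` helper (H4a of #20a's road b2): carrier
bookkeeping for complex conjugation, no printed citation discharged; H4b (the #20a clause at a non-canonical `ι` from the canonical one) is the sequel.

## References
* [Liu2021] Y. Liu, *Fourier–Jacobi cycles and arithmetic relative trace formula*, Camb. J. Math. 9 (2021) = arXiv:2102.11518: Def. 4.11, Rem. 4.4,
  App. D Lem. D.1 (2) (l. 5231), Lem. D.2 (2).
* [Li1992] J.-S. Li, J. reine angew. Math. 428 (1992), p. 181.  [Kudla1994] S. Kudla, Israel J. Math. 87 (1994), §1–§2 (`W⁻`).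
* [MoeglinVignerasWaldspurger1987] C. Mœglin, M.-F. Vignéras, J.-L. Waldspurger, LNM 1291, Chap. 2 II.1, Chap. 3 IV.
* [Weil1964] A. Weil, Acta Math. 111 (1964), Chap. III n° 37–41 pp. 188–194.  [FleigEtAl2018] §12.3 Def. 12.5 (12.37).
* [GelbartRogawski1991] S. Gelbart, J. Rogawski, Invent. Math. 105 (1991), §3.1 p. 454–457.
-/

set_option autoImplicit false
-- the mandated namespace repeats the single-problem summit's segment (`HodgeConjecture.HodgeConjecture`)
set_option linter.dupNamespace false

noncomputable section

open NumberField NumberField.mixedEmbedding IsDedekindDomain MeasureTheory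
open scoped TensorProduct SchwartzMap Matrix Classical ComplexConjugate
open Literature.NumberTheory.Automorphic Literature.NumberTheory.Automorphic.UnitaryGroup Literature.NumberTheory.Weil1964
open Literature.NumberTheory.GelbartRogawski1991 Literature.NumberTheory.GelbartRogawski1991.UnitaryDualPair
open HodgeCM.Model.HypCensus
open Literature.MeasureTheory.Group (cosetCongr continuous_cosetCongr cosetCongr_symm_apply forall_symm_mem_iff)
open HodgeCM.WeilCoinv (mirrorSplitting)
open Literature.NumberTheory.Automorphic.Liu2021.Def411WeilCarriersDoubling (splittingCongr)
open Summit.HodgeConjecture.HodgeConjecture.Cruxes.H413.WeilFinRepMirror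

namespace Summit.HodgeConjecture.HodgeConjecture.Cruxes.H413.K2E2CapArchPairMirrorKit

/-! ## §1 Complex conjugation of thin-coset test functions -/

section ThinCoset

variable {K : Type} [Field K] [NumberField K] {ι : Type} [Fintype ι]

/-- `C (Φ_∞ ⊗ 𝟙_{x₀ + 𝔫𝒪̂^ι}) = (C_∞ Φ_∞) ⊗ 𝟙_{x₀ + 𝔫𝒪̂^ι}` — the finite factor of a thin-coset test function is real. [folklore] -/
theorem piSchwartzBruhatConj_thinCosetTestFunₗ (x₀ : ι → FiniteAdeleRing (𝓞 K) K) (𝔫 : Ideal (𝓞 K))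
    (Φ : 𝓢((ι → mixedSpace K), ℂ)) :
    piSchwartzBruhatConj K ι (thinCosetTestFunₗ (K := K) (ι := ι) x₀ 𝔫 Φ) =
      thinCosetTestFunₗ (K := K) (ι := ι) x₀ 𝔫 (schwartzConj Φ) := by
  apply Subtype.ext
  funext v
  rw [coe_piSchwartzBruhatConj, Pi.star_apply, coe_thinCosetTestFunₗ, coe_thinCosetTestFunₗ]
  by_cases hv : -x₀ + piFinite K ι v ∈ piLevelIdeal K ι 𝔫
  · rw [thinCosetTestFun_of_mem Φ x₀ 𝔫 hv, thinCosetTestFun_of_mem (schwartzConj Φ) x₀ 𝔫 hv, schwartzConj_apply, Complex.star_def]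
  · rw [thinCosetTestFun_of_not_mem Φ x₀ 𝔫 hv, thinCosetTestFun_of_not_mem (schwartzConj Φ) x₀ 𝔫 hv, star_zero]

end ThinCoset

/-! ## §2 The archimedean Weil representation of the MIRROR splitting is the complex conjugate -/

section Mirror

variable (F E : Type) [Field F] [NumberField F] [Field E] [NumberField E] [Algebra F E] (c : E ≃ₐ[F] E)
  (N M : ℕ) {n : ℕ} (e : Fin N × Fin M ≃ Fin n) (JV : Matrix (Fin N) (Fin N) E) (JW : Matrix (Fin M) (Fin M) E)
  {TV : Matrix (Fin N) (Fin N) F} {TW : Matrix (Fin M) (Fin M) F}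
  [Algebra.IsQuadraticExtension F E] {δ : E} (hcδ : c δ = -δ) (hδ : δ ≠ 0) {d : F} (hd : δ * δ = algebraMap F E d)
  (hV : TV.IsSymm) (hW : TW.IsSymm) (hVd : IsUnit TV.det) (hWd : IsUnit TW.det)
  (hJV : JV = TV.map (algebraMap F E)) (hJW : JW = TW.map (algebraMap F E))
  (s : UnitaryGroup.adelicPair F E c N M JV JW →* adelicMpCont F (Fin n) (adelicGram F e TV TW))
  (hs : ∀ g, adelicMpCont.proj F (Fin n) (adelicGram F e TV TW) (s g) = toSp F E c N M e JV JW hcδ hδ hd hV hW hJV hJW g)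
  {TW₂ : Matrix (Fin M) (Fin M) F} {JW₂ : Matrix (Fin M) (Fin M) E} (hT : -TW = TW₂) (hJ : -JW = JW₂)
  (hW₂ : TW₂.IsSymm) (hWd₂ : IsUnit TW₂.det) (hJW₂ : JW₂ = TW₂.map (algebraMap F E))
  (hs₂ : ∀ g, adelicMpCont.proj F (Fin n) (adelicGram F e TV TW₂) (splittingCongr F E c N M e JV hT hJ (mirrorSplitting F E c N M e JV JW s) g) =
    toSp F E c N M e JV JW₂ hcδ hδ hd hV hW₂ hJV hJW₂ g)

set_option maxHeartbeats 4000000 in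
/-- **The archimedean Weil representation of the mirror splitting `s̄` on `(J_V, −J_W)` is the COMPLEX CONJUGATE of that of `s`**:
`archWeilRep[s̄] (x, ȳ) Ψ = C_∞ (archWeilRep[s] (x, y) (C_∞ Ψ))`, `ȳ` = `y` read in `U(J₂)(E ⊗ ℝ)` (same matrix), the mirror read at ANY W-data
`(T₂, J₂) = (−T_W, −J_W)` along ★ `splittingCongr` (`subst`).  The operator law
★ `omega_pairSplitting_mirrorSplitting` (`ω(s̄_pair(g, ū)) = C ω(s_pair(g, u)) C`) read on the archimedean factor through the thin-coset test
functions (★ `omega_thinCosetTestFunₗ`, ★ `archRepMp_unique`; their finite factor is real, §1).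
[cite: Li1992, p. 181] [cite: MoeglinVignerasWaldspurger1987, Chap. 2 II.1] [cite: Weil1964, Chap. III n° 37–38 p. 188–190] -/
theorem archWeilRep_mirrorSplitting_apply
    (x : UnitaryGroup.arch F E c N JV) (y : UnitaryGroup.arch F E c M JW) (y' : UnitaryGroup.arch F E c M JW₂)
    (hy : ((y' : GL (Fin M) (mixedSpace E)) = (y : GL (Fin M) (mixedSpace E))))
    (Ψ : 𝓢((Fin n → mixedSpace F), ℂ)) :
    archWeilRep F E c N M JV JW₂ hcδ hδ hd hV hW₂ hVd hWd₂ hJV hJW₂ e (splittingCongr F E c N M e JV hT hJ (mirrorSplitting F E c N M e JV JW s)) hs₂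
        (x, y') Ψ =
      schwartzConj (archWeilRep F E c N M JV JW hcδ hδ hd hV hW hVd hWd hJV hJW e s hs (x, y) (schwartzConj Ψ)) := by
  subst hT hJ
  -- the archimedean points `ȳ_𝔸`, `y_𝔸` have the same matrix
  have hu : (((UnitaryGroup.archToAdelic F E c M (-JW) y').1 : GL (Fin M) (AdeleRing (𝓞 E) E)) : Matrix (Fin M) (Fin M) (AdeleRing (𝓞 E) E)) =
      (((UnitaryGroup.archToAdelic F E c M JW y).1 : GL (Fin M) (AdeleRing (𝓞 E) E)) : Matrix (Fin M) (Fin M) (AdeleRing (𝓞 E) E)) := by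
    change ((GLn.ofInfinite M E (y' : GL (Fin M) (mixedSpace E)) : GL (Fin M) (AdeleRing (𝓞 E) E)) :
        Matrix (Fin M) (Fin M) (AdeleRing (𝓞 E) E)) = ((GLn.ofInfinite M E (y : GL (Fin M) (mixedSpace E))) : Matrix (Fin M) (Fin M) (AdeleRing (𝓞 E) E))
    rw [hy]
  -- the candidate operator `C_∞ ∘ archWeilRep[s](x, y) ∘ C_∞`, as a continuous `ℂ`-linear map
  let A : 𝓢((Fin n → mixedSpace F), ℂ) →L[ℂ] 𝓢((Fin n → mixedSpace F), ℂ) :=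
    schwartzConjConj
      (archRepMpCLM (Matrix.mulVec_surjective_iff_isUnit.2
          ((Matrix.isUnit_iff_isUnit_det _).2 (UnitaryDualPair.isUnit_det_adelicGram F e hVd hWd)))
        ((pairSplitting F E c N M e JV JW s).comp (archProdHom F E c N M JV JW))
        (hfin_pairSplitting_arch F E c N M JV JW hcδ hδ hd hV hW hJV hJW e s hs) (x, y))
  have hAΦ : ∀ Φ, A Φ = schwartzConj (archWeilRep F E c N M JV JW hcδ hδ hd hV hW hVd hWd hJV hJW e s hs (x, y) (schwartzConj Φ)) :=
    fun Φ => rfl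
  -- the test-function identity for the mirror pair splitting at `(x, ȳ)`
  have hA : ∀ Φ : 𝓢((Fin n → mixedSpace F), ℂ),
      adelicMpCont.omega F (Fin n) (adelicGram F e TV (-TW))
          (((pairSplitting F E c N M e JV (-JW) (mirrorSplitting F E c N M e JV JW s)).comp (archProdHom F E c N M JV (-JW))) (x, y'))
          (thinCosetTestFunₗ (K := F) (ι := Fin n) 0 ⊤ Φ) =
        thinCosetTestFunₗ (K := F) (ι := Fin n) 0 ⊤ ((A : 𝓢((Fin n → mixedSpace F), ℂ) →ₗ[ℂ] 𝓢((Fin n → mixedSpace F), ℂ)) Φ) := by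
    intro Φ
    have h1 := omega_pairSplitting_mirrorSplitting F E c N M e JV JW (s := s) (UnitaryGroup.archToAdelic F E c N JV x)
      (UnitaryGroup.archToAdelic F E c M JW y) (UnitaryGroup.archToAdelic F E c M (-JW) y') hu
      (thinCosetTestFunₗ (K := F) (ι := Fin n) 0 ⊤ Φ)
    have h2 := omega_thinCosetTestFunₗ (Matrix.mulVec_surjective_iff_isUnit.2
        ((Matrix.isUnit_iff_isUnit_det _).2 (UnitaryDualPair.isUnit_det_adelicGram F e hVd hWd)))
      ((pairSplitting F E c N M e JV JW s).comp (archProdHom F E c N M JV JW))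
      (hfin_pairSplitting_arch F E c N M JV JW hcδ hδ hd hV hW hJV hJW e s hs) (x, y) 0 ⊤ (schwartzConj Φ)
    refine h1.trans ?_
    rw [piSchwartzBruhatConj_thinCosetTestFunₗ]
    refine (congrArg (piSchwartzBruhatConj F (Fin n)) h2).trans ?_
    rw [piSchwartzBruhatConj_thinCosetTestFunₗ, ContinuousLinearMap.coe_coe, hAΦ, ← archRepMpCLM_apply]
    rfl
  have key := archRepMp_unique (Matrix.mulVec_surjective_iff_isUnit.2
      ((Matrix.isUnit_iff_isUnit_det _).2 (UnitaryDualPair.isUnit_det_adelicGram F e hVd hWd₂)))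
    ((pairSplitting F E c N M e JV (-JW) (mirrorSplitting F E c N M e JV JW s)).comp (archProdHom F E c N M JV (-JW)))
    (hfin_pairSplitting_arch F E c N M JV (-JW) hcδ hδ hd hV hW₂ hJV hJW₂ e _ hs₂) (x, y') 0 ⊤ hA
  have := LinearMap.congr_fun key Ψ
  rw [ContinuousLinearMap.coe_coe, hAΦ] at this
  unfold archWeilRep
  rw [archRepMp_apply] at this ⊢
  exact this.symm

/-- **Fixed vectors transfer through the mirror**: if `ȳ` fixes `Ψ` under `archWeilRep[s̄](x, ·)` then `y` fixes `C_∞ Ψ` under `archWeilRep[s](x, ·)`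
(the row (E) of #20a passes from the partner to the original datum). [cite: Li1992, p. 181] [cite: Liu2021, App. D Lemma D.1 (2)] -/
theorem archWeilRep_schwartzConj_eq_self_of_mirror_eq_self
    (x : UnitaryGroup.arch F E c N JV) (y : UnitaryGroup.arch F E c M JW) (y' : UnitaryGroup.arch F E c M JW₂)
    (hy : ((y' : GL (Fin M) (mixedSpace E)) = (y : GL (Fin M) (mixedSpace E))))
    {Ψ : 𝓢((Fin n → mixedSpace F), ℂ)}
    (hfix : archWeilRep F E c N M JV JW₂ hcδ hδ hd hV hW₂ hVd hWd₂ hJV hJW₂ e (splittingCongr F E c N M e JV hT hJ (mirrorSplitting F E c N M e JV JW s))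
      hs₂ (x, y') Ψ = Ψ) :
    archWeilRep F E c N M JV JW hcδ hδ hd hV hW hVd hWd hJV hJW e s hs (x, y) (schwartzConj Ψ) = schwartzConj Ψ := by
  have h := archWeilRep_mirrorSplitting_apply F E c N M e JV JW hcδ hδ hd hV hW hVd hWd hJV hJW s hs hT hJ hW₂ hWd₂ hJW₂ hs₂ x y y' hy Ψ
  rw [hfix] at h
  have h2 := congrArg schwartzConj h
  rw [schwartzConj_schwartzConj] at h2
  exact h2.symm

end Mirror

/-! ## §3 The theta KERNEL of the mirror splitting is the complex conjugate -/

section Kernel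

variable (F E : Type) [Field F] [NumberField F] [Field E] [NumberField E] [Algebra F E] (c : E ≃ₐ[F] E)
  (N M : ℕ) {n : ℕ} (e : Fin N × Fin M ≃ Fin n) (JV : Matrix (Fin N) (Fin N) E) (JW : Matrix (Fin M) (Fin M) E)
  {TV : Matrix (Fin N) (Fin N) F} {TW : Matrix (Fin M) (Fin M) F}
  [Algebra.IsQuadraticExtension F E] {δ : E} (hcδ : c δ = -δ) (hδ : δ ≠ 0) {d : F} (hd : δ * δ = algebraMap F E d)
  (hV : TV.IsSymm) (hW : TW.IsSymm) (hVd : IsUnit TV.det) (hWd : IsUnit TW.det)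
  (hJV : JV = TV.map (algebraMap F E)) (hJW : JW = TW.map (algebraMap F E))
  {s : UnitaryGroup.adelicPair F E c N M JV JW →* adelicMpCont F (Fin n) (adelicGram F e TV TW)}
  (hs : (splittingDatum F E c N M e JV JW hcδ hδ hd hV hW hVd hWd hJV hJW).IsCompatible s)
  (hρ : HasThetaMajorants fun (p : UnitaryGroup.adelic F E c N JV × UnitaryGroup.adelic F E c M JW)
    (Φ : piSchwartzBruhat F (Fin n)) => pairRep F E c N M e JV JW s p Φ)
  (SK : Set (piSchwartzBruhat F (Fin n)))
  (hSK : ∀ (h : UnitaryGroup.adelic F E c M JW) (Φ : piSchwartzBruhat F (Fin n)), Φ ∈ SK → pairRep F E c N M e JV JW s (1, h) Φ ∈ SK)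
  [LocallyCompactSpace (UnitaryGroup.adelic F E c N JV)] [LocallyCompactSpace (UnitaryGroup.adelic F E c M JW)]

set_option maxHeartbeats 4000000 in
/-- **THE THETA KERNEL OF THE MIRROR SPLITTING (read at any W-data `(T₂, J₂) = (−T_W, −J_W)`) IS THE COMPLEX CONJUGATE**:
`θ^{s̄}_Ψ(x, ū) = conj θ^{s}_{CΨ}(x, u)` for `ū`, `u` with the same matrix — ★ `thetaKernelDatum_thetaFun_mk` (`θ_Φ(x,h) = Θ(ω(s_pair(x⁻¹,h⁻¹))Φ)`),
the operator law ★ `omega_pairSplitting_mirrorSplitting` and `Θ ∘ C = conj ∘ Θ` (★ `thetaDistLM_piSchwartzBruhatConj`).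
[cite: Li1992, p. 181] [cite: Weil1964, Chap. III n° 41 Thm 6 p. 193] [cite: MoeglinVignerasWaldspurger1987, Chap. 2 II.1] -/
theorem thetaKernelDatum_mirror_thetaFun {TW₂ : Matrix (Fin M) (Fin M) F} {JW₂ : Matrix (Fin M) (Fin M) E} (hT : -TW = TW₂) (hJ : -JW = JW₂)
    (hW₂ : TW₂.IsSymm) (hWd₂ : IsUnit TW₂.det) (hJW₂ : JW₂ = TW₂.map (algebraMap F E)) [LocallyCompactSpace (UnitaryGroup.adelic F E c M JW₂)]
    (hs₂ : (splittingDatum F E c N M e JV JW₂ hcδ hδ hd hV hW₂ hVd hWd₂ hJV hJW₂).IsCompatible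
      (splittingCongr F E c N M e JV hT hJ (mirrorSplitting F E c N M e JV JW s)))
    (hρ₂ : HasThetaMajorants fun (p : UnitaryGroup.adelic F E c N JV × UnitaryGroup.adelic F E c M JW₂) (Φ : piSchwartzBruhat F (Fin n)) =>
      pairRep F E c N M e JV JW₂ (splittingCongr F E c N M e JV hT hJ
        (mirrorSplitting F E c N M e JV JW s)) p Φ)
    (SK₂ : Set (piSchwartzBruhat F (Fin n)))
    (hSK₂ : ∀ (h : UnitaryGroup.adelic F E c M JW₂) (Φ : piSchwartzBruhat F (Fin n)), Φ ∈ SK₂ →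
      pairRep F E c N M e JV JW₂ (splittingCongr F E c N M e JV hT hJ
        (mirrorSplitting F E c N M e JV JW s)) (1, h) Φ ∈ SK₂)
    (Ψ : piSchwartzBruhat F (Fin n)) (x : UnitaryGroup.adelic F E c N JV) (u : UnitaryGroup.adelic F E c M JW) (u₂ : UnitaryGroup.adelic F E c M JW₂)
    (hu : ((u₂ : GL (Fin M) (AdeleRing (𝓞 E) E)) : Matrix (Fin M) (Fin M) (AdeleRing (𝓞 E) E)) = (u : GL (Fin M) (AdeleRing (𝓞 E) E))) :
    (thetaKernelDatum F E c N M e JV JW₂ hcδ hδ hd hV hW₂ hVd hWd₂ hJV hJW₂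
        (splittingCongr F E c N M e JV hT hJ (mirrorSplitting F E c N M e JV JW s))
        hs₂ hρ₂ SK₂ hSK₂).thetaFun Ψ (x, u₂) =
      conj ((thetaKernelDatum F E c N M e JV JW hcδ hδ hd hV hW hVd hWd hJV hJW s hs hρ SK hSK).thetaFun (piSchwartzBruhatConj F (Fin n) Ψ) (x, u)) := by
  subst hT hJ
  -- inverses have the same matrix too
  have hu' : ((u₂⁻¹ : UnitaryGroup.adelic F E c M (-JW)) : GL (Fin M) (AdeleRing (𝓞 E) E)) = ((u⁻¹ : UnitaryGroup.adelic F E c M JW) : GL (Fin M) (AdeleRing (𝓞 E) E)) := by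
    rw [Subgroup.coe_inv, Subgroup.coe_inv, Units.ext hu]
  rw [thetaKernelDatum_thetaFun_mk, thetaKernelDatum_thetaFun_mk]
  exact (congrArg (thetaDistLM F (Fin n))
    (omega_pairSplitting_mirrorSplitting F E c N M e JV JW (s := s) x⁻¹ u⁻¹ u₂⁻¹ (congrArg (fun g : GL (Fin M) (AdeleRing (𝓞 E) E) =>
      (g : Matrix (Fin M) (Fin M) (AdeleRing (𝓞 E) E))) hu') Ψ)).trans (thetaDistLM_piSchwartzBruhatConj _)

end Kernel

/-! ## §4 Complex-conjugate transport of theta lifts (generic `Weil1964.ThetaKernelDatum`) -/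

section Transport

universe u v u' v'

variable {Mp : Type u} {SX : Type v} [TopologicalSpace Mp] [Group Mp] [TopologicalSpace SX]
variable {SX' : Type v'} [TopologicalSpace SX']
variable {GU : Type*} [Group GU] [TopologicalSpace GU] [IsTopologicalGroup GU] {ΓU : Subgroup GU}
variable {G : Type*} [Group G] [TopologicalSpace G] [IsTopologicalGroup G] {Γ : Subgroup G}
variable {Mp' : Type u'} [TopologicalSpace Mp'] [Group Mp']
variable {GU' : Type*} [Group GU'] [TopologicalSpace GU'] [IsTopologicalGroup GU'] {ΓU' : Subgroup GU'}
variable {G' : Type*} [Group G'] [TopologicalSpace G'] [IsTopologicalGroup G'] {Γ' : Subgroup G'}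
variable (K₁ : ThetaKernelDatum Mp SX GU ΓU G Γ) (K₂ : ThetaKernelDatum Mp' SX' GU' ΓU' G' Γ') (T : SX' → SX)

/-- **(K̄) on representatives ⇒ (K̄) on the quotients**: if `θ′_Φ(x′, y′) = conj θ_{TΦ}(φU x′, φ y′)` and `a`, `b` are the induced maps on the
coset spaces, then `θ′_Φ(ξ′, q′) = conj θ_{TΦ}(b ξ′, a q′)`. [cite: Li1992, p. 181] [cite: FleigEtAl2018, §12.3 (12.37)–(12.38)] -/
theorem thetaKer_conj_rel_of_thetaFun_conj_rel_map {φU : GU' → GU} {φ : G' → G}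
    (hθ : ∀ (Φ : SX') (x' : GU') (y' : G'), K₂.thetaFun Φ (x', y') = conj (K₁.thetaFun (T Φ) (φU x', φ y')))
    {a : G' ⧸ Γ' → G ⧸ Γ} {b : GU' ⧸ ΓU' → GU ⧸ ΓU}
    (ha : ∀ y' : G', a (QuotientGroup.mk y') = QuotientGroup.mk (φ y'))
    (hb : ∀ x' : GU', b (QuotientGroup.mk x') = QuotientGroup.mk (φU x'))
    (Φ : SX') (ξ' : GU' ⧸ ΓU') (q' : G' ⧸ Γ') :
    K₂.thetaKer Φ (ξ', q') = conj (K₁.thetaKer (T Φ) (b ξ', a q')) := by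
  induction ξ' using QuotientGroup.induction_on with
  | H x' =>
    induction q' using QuotientGroup.induction_on with
    | H y' =>
      rw [hb, ha, ThetaKernelDatum.thetaKer_apply, ThetaKernelDatum.thetaKer_apply, ThetaKernelDatum.thetaQuot_mk,
        ThetaKernelDatum.thetaQuot_mk, hθ]

variable [CompactSpace (GU ⧸ ΓU)] [CompactSpace (G ⧸ Γ)] [MeasurableSpace (G ⧸ Γ)] [BorelSpace (G ⧸ Γ)]
variable [CompactSpace (GU' ⧸ ΓU')] [CompactSpace (G' ⧸ Γ')] [MeasurableSpace (G' ⧸ Γ')] [BorelSpace (G' ⧸ Γ')]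
  (μ' : Measure (G' ⧸ Γ')) [IsFiniteMeasure μ']

/-- **CONJUGATE TRANSPORT OF THE THETA LIFT**: under (K̄) `θ′_Φ(ξ′, q′) = conj θ_{TΦ}(b ξ′, a q′)` with `a` continuous, and for test
functions matched by `f′(q′) = conj f(a q′)`, `Θ′_Φ(f′)(ξ′) = conj Θ_{TΦ}(f)(b ξ′)` with the unprimed lift against the push-forward `a_* μ′`
(change of variables + `∫ conj = conj ∫`). [cite: FleigEtAl2018, §12.3 Definition 12.5 (12.37)] [cite: Li1992, p. 181] -/
theorem thetaLift_apply_of_thetaKer_conj_rel_map (a : C(G' ⧸ Γ', G ⧸ Γ)) (b : GU' ⧸ ΓU' → GU ⧸ ΓU)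
    (hker : ∀ (Φ : SX') (ξ' : GU' ⧸ ΓU') (q' : G' ⧸ Γ'), K₂.thetaKer Φ (ξ', q') = conj (K₁.thetaKer (T Φ) (b ξ', a q')))
    (Φ : SX') {f : C(G ⧸ Γ, ℂ)} {f' : C(G' ⧸ Γ', ℂ)} (hf : ∀ q' : G' ⧸ Γ', f' q' = conj (f (a q'))) (ξ' : GU' ⧸ ΓU') :
    K₂.thetaLift μ' Φ f' ξ' = conj (K₁.thetaLift (μ'.map a) (T Φ) f (b ξ')) := by
  haveI : IsFiniteMeasure (μ'.map a) := Measure.isFiniteMeasure_map μ' a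
  have hcont : Continuous fun q : G ⧸ Γ => K₁.thetaKer (T Φ) (b ξ', q) * f q :=
    ((K₁.thetaKer (T Φ)).continuous.comp (Continuous.prodMk_right (b ξ'))).mul f.continuous
  rw [ThetaKernelDatum.thetaLift_apply, ThetaKernelDatum.thetaLift_apply,
    integral_map a.continuous.measurable.aemeasurable hcont.aestronglyMeasurable, ← integral_conj]
  refine integral_congr_ae (Filter.Eventually.of_forall fun q' => ?_)
  simp only
  rw [hker, hf, map_mul]

/-- **CONJUGATE TRANSPORT ALONG A GROUP IDENTIFICATION OF THE SECOND FACTOR** (the shape H4b consumes: same first factor, `e : G′ ≃* G` matching the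
arithmetic subgroups, kernel relation on representatives): `Θ′_Φ(f′)(ξ) = conj Θ_{TΦ}((conj ∘ f′) ∘ ē⁻¹)(ξ)`, the unprimed lift against `ē_* μ′`
(`ē = cosetCongr e`). [cite: FleigEtAl2018, §12.3 Definition 12.5 (12.37)] [cite: Li1992, p. 181] -/
theorem thetaLift_conj_cosetCongr_apply_map {K₃ : ThetaKernelDatum Mp' SX' GU ΓU G' Γ'}
    (e : G' ≃* G) (hΓ : ∀ y', e y' ∈ Γ ↔ y' ∈ Γ') (he : Continuous e) (hes : Continuous e.symm)
    (hθ : ∀ (Φ : SX') (x : GU) (y' : G'), K₃.thetaFun Φ (x, y') = conj (K₁.thetaFun (T Φ) (x, e y')))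
    (Φ : SX') (f' : C(G' ⧸ Γ', ℂ)) (ξ : GU ⧸ ΓU) :
    K₃.thetaLift μ' Φ f' ξ =
      conj (K₁.thetaLift (μ'.map (cosetCongr e Γ' Γ hΓ)) (T Φ)
        ((star f').comp ⟨cosetCongr e.symm Γ Γ' (forall_symm_mem_iff e Γ' Γ hΓ), continuous_cosetCongr e.symm Γ Γ' (forall_symm_mem_iff e Γ' Γ hΓ) hes⟩) ξ) := by
  refine thetaLift_apply_of_thetaKer_conj_rel_map K₁ K₃ T μ' ⟨cosetCongr e Γ' Γ hΓ, continuous_cosetCongr e Γ' Γ hΓ he⟩ id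
    (thetaKer_conj_rel_of_thetaFun_conj_rel_map K₁ K₃ T (φU := id) (φ := e) hθ (fun _ => rfl) (fun _ => rfl)) Φ (fun q' => ?_) ξ
  change f' q' = conj ((star f') (cosetCongr e.symm Γ Γ' (forall_symm_mem_iff e Γ' Γ hΓ) (cosetCongr e Γ' Γ hΓ q')))
  rw [cosetCongr_symm_apply, ContinuousMap.star_apply, RCLike.star_def, Complex.conj_conj]

end Transport

/-! ## §5 The sign of `J_W` does not change the unitary groups: archimedean points, rational ranges, continuity of the identifications -/

section Neg

variable (F E : Type) [Field F] [NumberField F] [Field E] [NumberField E] [Algebra F E] (c : E ≃ₐ[F] E)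
  (M : ℕ) (JW : Matrix (Fin M) (Fin M) E)

omit [NumberField F] [NumberField E] in
/-- **`U(−J)(E ⊗ ℝ) = U(J)(E ⊗ ℝ)`** as subgroups of `GL_M(E ⊗ ℝ)` (`ḡᵀ(−J)g = −J ↔ ḡᵀJg = J`). [cite: Kudla1994, §2] -/
theorem arch_neg : UnitaryGroup.arch F E c M (-JW) = UnitaryGroup.arch F E c M JW := by
  change unitaryGroupOfForm _ (UnitaryGroup.archFormOf E M (-JW)) = unitaryGroupOfForm _ (UnitaryGroup.archFormOf E M JW)
  rw [show UnitaryGroup.archFormOf E M (-JW) = -UnitaryGroup.archFormOf E M JW from Matrix.map_neg _ (map_neg (mixedEmbedding E)) JW,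
    Literature.NumberTheory.GelbartRogawski1991.GRConstruction.unitaryGroupOfForm_neg']

omit [NumberField F] [NumberField E] in
/-- **`U(−J)(F) = U(J)(F)`** as subgroups of `GL_M(E)`. [cite: Kudla1994, §2] -/
theorem rational_neg : UnitaryGroup.rational F E c M (-JW) = UnitaryGroup.rational F E c M JW := by
  unfold UnitaryGroup.rational
  rw [Literature.NumberTheory.GelbartRogawski1991.GRConstruction.unitaryGroupOfForm_neg']

omit [NumberField F] in
/-- the identification `U(J)(𝔸) = U(−J)(𝔸)` (★ `adelic_neg`, identity on matrices) matches the rational points: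
`ȳ ∈ U(−J)(F) ↔ y ∈ U(J)(F)`. [cite: Kudla1994, §2] [cite: GelbartRogawski1991, §3.1 p. 454] -/
theorem subgroupCongr_mem_range_toAdelic_neg_iff (y : UnitaryGroup.adelic F E c M JW) :
    MulEquiv.subgroupCongr (UnitaryGroup.adelic_neg F E c M JW).symm y ∈ (UnitaryGroup.toAdelic F E c M (-JW)).range ↔
      y ∈ (UnitaryGroup.toAdelic F E c M JW).range := by
  rw [Literature.NumberTheory.Automorphic.DoubledUnitary.RankOneReduction.mem_range_toAdelic_iff,
    Literature.NumberTheory.Automorphic.DoubledUnitary.RankOneReduction.mem_range_toAdelic_iff, MulEquiv.subgroupCongr_apply]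

omit [NumberField F] in
/-- the identification `U(J)(𝔸) = U(−J)(𝔸)` is continuous (identity on matrices). [cite: Kudla1994, §2] -/
theorem continuous_subgroupCongr_adelic_neg_symm : Continuous (MulEquiv.subgroupCongr (UnitaryGroup.adelic_neg F E c M JW).symm) :=
  continuous_induced_rng.2 (by
    have h : (fun y : UnitaryGroup.adelic F E c M JW =>
        ((MulEquiv.subgroupCongr (UnitaryGroup.adelic_neg F E c M JW).symm y : UnitaryGroup.adelic F E c M (-JW)) :
          GL (Fin M) (AdeleRing (𝓞 E) E))) = fun y : UnitaryGroup.adelic F E c M JW => (y : GL (Fin M) (AdeleRing (𝓞 E) E)) :=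
      funext fun y => MulEquiv.subgroupCongr_apply _ _
    rw [Function.comp_def, h]
    exact continuous_subtype_val)

omit [NumberField F] in
/-- … and so is its inverse. [cite: Kudla1994, §2] -/
theorem continuous_subgroupCongr_adelic_neg_symm_symm :
    Continuous (MulEquiv.subgroupCongr (UnitaryGroup.adelic_neg F E c M JW).symm).symm :=
  continuous_induced_rng.2 (by
    have h : (fun y : UnitaryGroup.adelic F E c M (-JW) =>
        (((MulEquiv.subgroupCongr (UnitaryGroup.adelic_neg F E c M JW).symm).symm y : UnitaryGroup.adelic F E c M JW) :
          GL (Fin M) (AdeleRing (𝓞 E) E))) = fun y : UnitaryGroup.adelic F E c M (-JW) => (y : GL (Fin M) (AdeleRing (𝓞 E) E)) :=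
      funext fun y => MulEquiv.subgroupCongr_symm_apply _ _
    rw [Function.comp_def, h]
    exact continuous_subtype_val)

end Neg

end Summit.HodgeConjecture.HodgeConjecture.Cruxes.H413.K2E2CapArchPairMirrorKit

end
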